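import Literature.Computability.QuantumComplexity.RevMultiplex
import HarnessLib

/-!
# Classical reversible gadgets for the circuit simulation of quantum Turing machines: Fredkin gates, register swaps, controlled rotations

Toolkit over an abstract wire type `ι`, continuing `RevGadgets.lean` (`ClOp ι` programs of
`NOT`/`CNOT`/Toffoli, `clEval`) and `RevMultiplex.lean` (`RevMux.swapOps`), for the
quantum-circuit simulation of a quantum Turing machine (Yao 1993; Nishimura–Ozawa 2002,
Thm. 4.3): the head position of the machine is kept in *unary* (one flag wire per cell of the
computation window, as the two "head" bits of each cell of Nishimura–Ozawa's circuit), and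
everything a step does besides the one local unitary is classical and reversible —

* `cswap c a b` — the **Fredkin gate** (controlled swap) as `CNOT b a; Toffoli c a b; CNOT b a`
  (Nielsen–Chuang 2010, §3.2.5, Fig. 3.16 and Ex. 4.25 — here only its classical action is
  used): if `w c` then the values of `a` and `b` are exchanged, otherwise nothing happens
  (`clEval_cswap`);
* `cswapRegs c as bs` — Fredkin gates wire by wire between two registers: controlled exchange
  of the two registers (`clEval_cswapRegs_true/false/of_not_mem`); used to bring the scanned
  tape cell to the fixed register on which the local unitary acts, and back;
* `rotR c h W`, `rotL c h W` — **controlled cyclic rotations** of the track `h 0, …, h (W-1)`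
  by adjacent Fredkin gates (a one-hot head marker moves one cell to the right, resp. left, when
  the control is set: `clEval_rotR_succ`, `clEval_rotL_of_succ`, and the identity otherwise);
* `xorInto srcs t` — `CNOT`s accumulating the parity of `srcs` into `t` (`clEval_xorInto_target`):
  with a one-hot state register, the parity over the states moving right IS the direction bit;
* `writeSel x tgt e₀ e₁ ks` — writing into fresh wires the constant pattern `e₁` if `w x` else
  `e₀` (`NOT`s and `CNOT`s controlled by `x`; `clEval_writeSel_tgt`): loading an input bit as the
  code of its tape symbol.

All lemmas are elementary bookkeeping; well-formedness (`ClOp.WF`, pairwise distinct wires of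
each operation) is recorded for the compilation to Clifford+`T` words (`toRevList`,
`revCompile`).

## References

* M. A. Nielsen, I. L. Chuang, *Quantum Computation and Quantum Information*, CUP 2010, §1.3.4
  (swap from three `CNOT`s), §3.2.5 (Fredkin and Toffoli gates, reversible classical
  computation), Ex. 4.25 (Fredkin from Toffoli and `CNOT`s) [NielsenChuang2010].
* H. Nishimura, M. Ozawa, *Computational complexity of uniform quantum circuit families and
  quantum Turing machines*, Theoret. Comput. Sci. 276 (2002) 147–181, proof of Thm. 4.3 (cells
  with head marks; the marker-moving gate `G₂`) [NishimuraOzawa2002].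
* A. C.-C. Yao, *Quantum circuit complexity*, Proc. 34th FOCS (1993) 352–361 [YaoFOCS1993].
-/

namespace Literature.Computability.QuantumComplexity

open Function

namespace YaoSim

variable {ι : Type*}

/-! ### The Fredkin gate -/

/-- The **Fredkin gate** (controlled swap of `a` and `b`, control `c`) as a classical reversible
word: `CNOT b a; Toffoli c a b; CNOT b a`. [cite: NielsenChuang2010, §3.2.5 and Ex. 4.25] -/
def cswap (c a b : ι) : List (ClOp ι) :=
  [ClOp.cnot b a, ClOp.toffoli c a b, ClOp.cnot b a]

/-- The operations of a Fredkin word are well formed when its three wires are distinct. [folklore] -/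
theorem wf_of_mem_cswap {c a b : ι} (hca : c ≠ a) (hcb : c ≠ b) (hab : a ≠ b) {op : ClOp ι}
    (hop : op ∈ cswap c a b) : op.WF := by
  simp only [cswap, List.mem_cons, List.not_mem_nil, or_false] at hop
  rcases hop with rfl | rfl | rfl
  · exact hab.symm
  · exact ⟨hca, hcb, hab⟩
  · exact hab.symm

/-- The targets of a Fredkin word are `a` and `b`. [folklore] -/
theorem target_mem_of_mem_cswap {c a b : ι} {op : ClOp ι} (hop : op ∈ cswap c a b) :
    op.target = a ∨ op.target = b := by
  simp only [cswap, List.mem_cons, List.not_mem_nil, or_false] at hop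
  rcases hop with rfl | rfl | rfl
  · exact Or.inl rfl
  · exact Or.inr rfl
  · exact Or.inl rfl

variable [DecidableEq ι]

/-- **Semantics of the Fredkin gate**: if the control is set the values of `a` and `b` are
exchanged, otherwise the assignment is unchanged. [cite: NielsenChuang2010, §3.2.5] -/
theorem clEval_cswap {c a b : ι} (hca : c ≠ a) (hcb : c ≠ b) (hab : a ≠ b) (w : ι → Bool) :
    clEval (cswap c a b) w =
      fun i => if i = a then (if w c then w b else w a)
        else if i = b then (if w c then w a else w b) else w i := by
  set w1 : ι → Bool := update w a (w a ^^ w b) with hw1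
  have h1a : w1 a = (w a ^^ w b) := update_self _ _ _
  have h1b : w1 b = w b := update_of_ne (Ne.symm hab) _ _
  have h1c : w1 c = w c := update_of_ne hca _ _
  set w2 : ι → Bool := update w1 b (w1 b ^^ (w1 c && w1 a)) with hw2
  have h2a : w2 a = (w a ^^ w b) := by rw [hw2, update_of_ne hab, h1a]
  have h2b : w2 b = (w b ^^ (w c && (w a ^^ w b))) := by rw [hw2, update_self, h1b, h1c, h1a]
  have hstep : clEval (cswap c a b) w = update w2 a (w2 a ^^ w2 b) := by
    simp only [cswap, clEval_cons, clEval_nil, ClOp.eval_cnot, ClOp.eval_toffoli, hw1, hw2]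
  rw [hstep]
  funext i
  by_cases hia : i = a
  · subst hia
    rw [update_self, h2a, h2b, if_pos rfl]
    cases w i <;> cases w b <;> cases w c <;> rfl
  · rw [update_of_ne hia, if_neg hia]
    by_cases hib : i = b
    · subst hib
      rw [h2b, if_pos rfl]
      cases w i <;> cases w a <;> cases w c <;> rfl
    · rw [if_neg hib, hw2, update_of_ne hib, hw1, update_of_ne hia]

/-- Fredkin gate, control set: the two values are exchanged. [cite: NielsenChuang2010, §3.2.5] -/
theorem clEval_cswap_of_true {c a b : ι} (hca : c ≠ a) (hcb : c ≠ b) (hab : a ≠ b) (w : ι → Bool)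
    (hc : w c = true) :
    clEval (cswap c a b) w = fun i => if i = a then w b else if i = b then w a else w i := by
  rw [clEval_cswap hca hcb hab]
  simp [hc]

/-- Fredkin gate, control off: the identity. [cite: NielsenChuang2010, §3.2.5] -/
theorem clEval_cswap_of_false {c a b : ι} (hca : c ≠ a) (hcb : c ≠ b) (hab : a ≠ b) (w : ι → Bool)
    (hc : w c = false) : clEval (cswap c a b) w = w := by
  rw [clEval_cswap hca hcb hab]
  funext i
  by_cases hia : i = a
  · subst hia; simp [hc]
  · by_cases hib : i = b
    · subst hib; simp [hc, hia]
    · simp [hia, hib]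

/-! ### Controlled exchange of two registers -/

/-- Fredkin gates with the common control `c` between corresponding wires of two registers
`as`, `bs` (zipped; meant for registers of the same length). [cite: NielsenChuang2010, §3.2.5] -/
def cswapRegs (c : ι) : List ι → List ι → List (ClOp ι)
  | a :: as, b :: bs => cswap c a b ++ cswapRegs c as bs
  | _, _ => []

omit [DecidableEq ι] in
/-- `cswapRegs` on two non-empty registers. [folklore] -/
@[simp] theorem cswapRegs_cons (c a b : ι) (as bs : List ι) :
    cswapRegs c (a :: as) (b :: bs) = cswap c a b ++ cswapRegs c as bs := rfl

omit [DecidableEq ι] in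
/-- `cswapRegs` with an empty first register. [folklore] -/
@[simp] theorem cswapRegs_nil_left (c : ι) (bs : List ι) : cswapRegs c [] bs = [] := rfl

omit [DecidableEq ι] in
/-- `cswapRegs` with an empty second register. [folklore] -/
@[simp] theorem cswapRegs_nil_right (c : ι) (as : List ι) : cswapRegs c as [] = [] := by
  cases as <;> rfl

omit [DecidableEq ι] in
/-- Every operation of `cswapRegs c as bs` belongs to a Fredkin word `cswap c a b` with `a ∈ as`,
`b ∈ bs` at the same index. [folklore] -/
theorem exists_of_mem_cswapRegs {c : ι} :
    ∀ {as bs : List ι} {op : ClOp ι}, op ∈ cswapRegs c as bs →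
      ∃ k : ℕ, ∃ a b, as[k]? = some a ∧ bs[k]? = some b ∧ op ∈ cswap c a b
  | [], _, _, h => by simp at h
  | _ :: _, [], _, h => by simp at h
  | a :: as, b :: bs, op, h => by
    rw [cswapRegs_cons, List.mem_append] at h
    rcases h with h | h
    · exact ⟨0, a, b, rfl, rfl, h⟩
    · obtain ⟨k, a', b', ha, hb, hop⟩ := exists_of_mem_cswapRegs h
      exact ⟨k + 1, a', b', by simpa using ha, by simpa using hb, hop⟩

omit [DecidableEq ι] in
/-- The targets of `cswapRegs c as bs` lie in `as ++ bs`. [folklore] -/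
theorem target_mem_of_mem_cswapRegs {c : ι} {as bs : List ι} {op : ClOp ι}
    (hop : op ∈ cswapRegs c as bs) : op.target ∈ as ∨ op.target ∈ bs := by
  obtain ⟨k, a, b, ha, hb, hop⟩ := exists_of_mem_cswapRegs hop
  rcases target_mem_of_mem_cswap hop with h | h
  · exact Or.inl (h ▸ List.mem_of_getElem? ha)
  · exact Or.inr (h ▸ List.mem_of_getElem? hb)

omit [DecidableEq ι] in
/-- Well-formedness of `cswapRegs`: the control is outside both registers and corresponding
wires differ. [folklore] -/
theorem wf_of_mem_cswapRegs {c : ι} {as bs : List ι} (hca : c ∉ as) (hcb : c ∉ bs)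
    (hab : ∀ k : ℕ, ∀ a b, as[k]? = some a → bs[k]? = some b → a ≠ b)
    {op : ClOp ι} (hop : op ∈ cswapRegs c as bs) : op.WF := by
  obtain ⟨k, a, b, ha, hb, hop⟩ := exists_of_mem_cswapRegs hop
  exact wf_of_mem_cswap (fun h : c = a => hca (h ▸ List.mem_of_getElem? ha))
    (fun h : c = b => hcb (h ▸ List.mem_of_getElem? hb)) (hab k a b ha hb) hop

/-- **Controlled exchange, control off**: the identity. [cite: NielsenChuang2010, §3.2.5] -/
theorem clEval_cswapRegs_of_false {c : ι} :
    ∀ {as bs : List ι}, c ∉ as → c ∉ bs →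
      (∀ k : ℕ, ∀ a b, as[k]? = some a → bs[k]? = some b → a ≠ b) →
      ∀ (w : ι → Bool), w c = false → clEval (cswapRegs c as bs) w = w
  | [], _, _, _, _, w, _ => by simp
  | _ :: _, [], _, _, _, w, _ => by simp
  | a :: as, b :: bs, hca, hcb, hab, w, hc => by
    simp only [List.mem_cons, not_or] at hca hcb
    rw [cswapRegs_cons, clEval_append,
      clEval_cswap_of_false hca.1 hcb.1 (hab 0 a b rfl rfl) w hc]
    exact clEval_cswapRegs_of_false hca.2 hcb.2
      (fun k a' b' ha hb => hab (k + 1) a' b' (by simpa using ha) (by simpa using hb)) w hc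

/-- **Controlled exchange, control set**: corresponding wires of the two registers exchange
their values and nothing else moves (registers duplicate-free, disjoint, not containing the
control). [cite: NielsenChuang2010, §3.2.5] -/
theorem clEval_cswapRegs_of_true {c : ι} :
    ∀ {as bs : List ι}, c ∉ as → c ∉ bs → as.Nodup → bs.Nodup → (∀ a ∈ as, a ∉ bs) →
      as.length = bs.length → ∀ (w : ι → Bool), w c = true →
      (∀ k : ℕ, ∀ a b, as[k]? = some a → bs[k]? = some b →
          clEval (cswapRegs c as bs) w a = w b ∧ clEval (cswapRegs c as bs) w b = w a) ∧
        ∀ i, i ∉ as → i ∉ bs → clEval (cswapRegs c as bs) w i = w i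
  | [], bs, _, _, _, _, _, _, w, _ => by simp
  | _ :: _, [], _, _, _, _, _, hl, w, _ => by simp at hl
  | a :: as, b :: bs, hca, hcb, hna, hnb, hdis, hl, w, hc => by
    simp only [List.mem_cons, not_or] at hca hcb
    rw [List.nodup_cons] at hna hnb
    have hab : a ≠ b := fun h => hdis a (by simp) (by simp [h])
    have hdis' : ∀ a' ∈ as, a' ∉ bs := fun a' ha' hb' => hdis a' (by simp [ha']) (by simp [hb'])
    have habs : a ∉ bs := fun h => hdis a (by simp) (by simp [h])
    have hbas : b ∉ as := fun h => hdis b (by simp [h]) (by simp)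
    have hw'eq := clEval_cswap_of_true hca.1 hcb.1 hab w hc
    have hc' : clEval (cswap c a b) w c = true := by
      rw [hw'eq]; simp [hca.1, hcb.1, hc]
    obtain ⟨ih₁, ih₂⟩ := clEval_cswapRegs_of_true hca.2 hcb.2 hna.2 hnb.2 hdis'
      (by simpa using hl) (clEval (cswap c a b) w) hc'
    simp only [cswapRegs_cons, clEval_append]
    refine ⟨fun k a' b' ha hb => ?_, fun i hia hib => ?_⟩
    · cases k with
      | zero =>
        simp only [List.getElem?_cons_zero, Option.some.injEq] at ha hb
        subst ha hb
        rw [ih₂ a hna.1 habs, ih₂ b hbas hnb.1, hw'eq]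
        simp [hab.symm]
      | succ k =>
        simp only [List.getElem?_cons_succ] at ha hb
        obtain ⟨e₁, e₂⟩ := ih₁ k a' b' ha hb
        have ha' : a' ∈ as := List.mem_of_getElem? ha
        have hb' : b' ∈ bs := List.mem_of_getElem? hb
        have h1 : a' ≠ a := fun h => hna.1 (h ▸ ha')
        have h2 : a' ≠ b := fun h => hbas (h ▸ ha')
        have h3 : b' ≠ a := fun h => habs (h ▸ hb')
        have h4 : b' ≠ b := fun h => hnb.1 (h ▸ hb')
        rw [e₁, e₂, hw'eq]
        simp [h1, h2, h3, h4]
    · simp only [List.mem_cons, not_or] at hia hib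
      rw [ih₂ i hia.2 hib.2, hw'eq]
      simp [hia.1, hib.1]

/-! ### Controlled rotations of a track -/

/-- **Controlled rotation to the right** of the track `h 0, …, h (W - 1)`: adjacent Fredkin gates
from the right end to the left end (`(W-2, W-1)` first, `(0, 1)` last). With the control set,
the value of `h j` moves to `h (j + 1)` and that of `h (W - 1)` to `h 0`; in the simulation the
track carries the one-hot head marker, which never sits at the right end when moving right
(Nishimura–Ozawa 2002, proof of Thm. 4.3, the gate `G₂` moving the head mark). [cite: NishimuraOzawa2002, Thm. 4.3 (proof)] -/
def rotR (c : ι) (h : ℕ → ι) : ℕ → List (ClOp ι)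
  | 0 => []
  | W + 1 => (match W with
      | 0 => []
      | W' + 1 => cswap c (h W') (h (W' + 1))) ++ rotR c h W

/-- **Controlled rotation to the left**: adjacent Fredkin gates from the left end to the right
end (`(0, 1)` first); with the control set the value of `h (j + 1)` moves to `h j` and that of
`h 0` to `h (W - 1)`. [cite: NishimuraOzawa2002, Thm. 4.3 (proof)] -/
def rotL (c : ι) (h : ℕ → ι) (W : ℕ) : List (ClOp ι) :=
  (List.range (W - 1)).flatMap fun j => cswap c (h j) (h (j + 1))

omit [DecidableEq ι] in
/-- `rotR` on a track of length `W + 2`: first the Fredkin gate on the last two cells, then the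
rotation of the first `W + 1` cells. [folklore] -/
theorem rotR_succ_succ (c : ι) (h : ℕ → ι) (W : ℕ) :
    rotR c h (W + 2) = cswap c (h W) (h (W + 1)) ++ rotR c h (W + 1) := rfl

omit [DecidableEq ι] in
/-- `rotR` on a track of length `1` is empty. [folklore] -/
@[simp] theorem rotR_one (c : ι) (h : ℕ → ι) : rotR c h 1 = [] := rfl

omit [DecidableEq ι] in
/-- `rotR` on the empty track is empty. [folklore] -/
@[simp] theorem rotR_zero (c : ι) (h : ℕ → ι) : rotR c h 0 = [] := rfl

omit [DecidableEq ι] in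
/-- Every operation of `rotR c h W` lies in a Fredkin word `cswap c (h j) (h (j+1))`, `j + 1 < W`. [folklore] -/
theorem exists_of_mem_rotR {c : ι} {h : ℕ → ι} :
    ∀ {W : ℕ} {op : ClOp ι}, op ∈ rotR c h W → ∃ j, j + 1 < W ∧ op ∈ cswap c (h j) (h (j + 1))
  | 0, _, hop => by simp at hop
  | 1, _, hop => by simp at hop
  | W + 2, op, hop => by
    rw [rotR_succ_succ, List.mem_append] at hop
    rcases hop with hop | hop
    · exact ⟨W, by omega, hop⟩
    · obtain ⟨j, hj, hop⟩ := exists_of_mem_rotR hop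
      exact ⟨j, by omega, hop⟩

omit [DecidableEq ι] in
/-- Every operation of `rotL c h W` lies in a Fredkin word `cswap c (h j) (h (j+1))`, `j + 1 < W`. [folklore] -/
theorem exists_of_mem_rotL {c : ι} {h : ℕ → ι} {W : ℕ} {op : ClOp ι} (hop : op ∈ rotL c h W) :
    ∃ j, j + 1 < W ∧ op ∈ cswap c (h j) (h (j + 1)) := by
  simp only [rotL, List.mem_flatMap, List.mem_range] at hop
  obtain ⟨j, hj, hop⟩ := hop
  exact ⟨j, by omega, hop⟩

omit [DecidableEq ι] in
/-- Well-formedness of the rotations: the control is off the track and the track wires are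
pairwise distinct. [folklore] -/
theorem wf_of_mem_rotR {c : ι} {h : ℕ → ι} {W : ℕ} (hc : ∀ j < W, c ≠ h j)
    (hinj : ∀ i < W, ∀ j < W, h i = h j → i = j) {op : ClOp ι} (hop : op ∈ rotR c h W) :
    op.WF := by
  obtain ⟨j, hj, hop⟩ := exists_of_mem_rotR hop
  exact wf_of_mem_cswap (hc j (by omega)) (hc (j + 1) hj)
    (fun e => by have := hinj j (by omega) (j + 1) hj e; omega) hop

omit [DecidableEq ι] in
/-- Well-formedness of the left rotation. [folklore] -/
theorem wf_of_mem_rotL {c : ι} {h : ℕ → ι} {W : ℕ} (hc : ∀ j < W, c ≠ h j)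
    (hinj : ∀ i < W, ∀ j < W, h i = h j → i = j) {op : ClOp ι} (hop : op ∈ rotL c h W) :
    op.WF := by
  obtain ⟨j, hj, hop⟩ := exists_of_mem_rotL hop
  exact wf_of_mem_cswap (hc j (by omega)) (hc (j + 1) hj)
    (fun e => by have := hinj j (by omega) (j + 1) hj e; omega) hop

/-- Rotations with the control off are the identity (right). The hypotheses: the control is off
the track and the track wires `h 0, …, h (W-1)` are pairwise distinct. [folklore] -/
theorem clEval_rotR_of_false {c : ι} {h : ℕ → ι} (w : ι → Bool) (hw : w c = false) :
    ∀ W : ℕ, (∀ j < W, c ≠ h j) → (∀ i < W, ∀ j < W, h i = h j → i = j) →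
      clEval (rotR c h W) w = w
  | 0, _, _ => rfl
  | 1, _, _ => rfl
  | W + 2, hc, hinj => by
    rw [rotR_succ_succ, clEval_append,
      clEval_cswap_of_false (hc W (by omega)) (hc (W + 1) (by omega))
        (fun e => by have := hinj W (by omega) (W + 1) (by omega) e; omega) w hw]
    exact clEval_rotR_of_false w hw (W + 1) (fun j hj => hc j (by omega))
      (fun i hi j hj => hinj i (by omega) j (by omega))

/-- Rotations with the control off are the identity (left). [folklore] -/
theorem clEval_rotL_of_false {c : ι} {h : ℕ → ι} {W : ℕ} (hc : ∀ j < W, c ≠ h j)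
    (hinj : ∀ i < W, ∀ j < W, h i = h j → i = j) (w : ι → Bool) (hw : w c = false) :
    clEval (rotL c h W) w = w := by
  unfold rotL
  suffices H : ∀ m, m < W →
      clEval ((List.range m).flatMap fun j => cswap c (h j) (h (j + 1))) w = w by
    rcases Nat.eq_zero_or_pos W with rfl | hW
    · rfl
    · exact H (W - 1) (by omega)
  intro m
  induction m with
  | zero => intro; rfl
  | succ m ih =>
    intro hm
    rw [List.range_succ, List.flatMap_append, clEval_append, ih (by omega), List.flatMap_singleton]
    exact clEval_cswap_of_false (hc m (by omega)) (hc (m + 1) hm)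
      (fun e => by have := hinj m (by omega) (m + 1) hm e; omega) w hw

/-- **Right rotation, control set.** Wires off the track keep their values, `h (j + 1)` receives
the value of `h j` (`j + 1 < W`) and `h 0` that of `h (W - 1)`. [cite: NishimuraOzawa2002, Thm. 4.3 (proof)] -/
theorem clEval_rotR_of_true {c : ι} {h : ℕ → ι} (w : ι → Bool) (hw : w c = true) :
    ∀ W : ℕ, (∀ j < W, c ≠ h j) → (∀ i < W, ∀ j < W, h i = h j → i = j) →
      (∀ i, (∀ j < W, i ≠ h j) → clEval (rotR c h W) w i = w i) ∧
      (∀ j, j + 1 < W → clEval (rotR c h W) w (h (j + 1)) = w (h j)) ∧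
      (0 < W → clEval (rotR c h W) w (h 0) = w (h (W - 1)))
  | 0, _, _ => by simp
  | 1, _, _ => by simp
  | W + 2, hc, hinj => by
    have hne : ∀ i < W + 2, ∀ j < W + 2, i ≠ j → h i ≠ h j :=
      fun i hi j hj hij e => hij (hinj i hi j hj e)
    have hw'eq := clEval_cswap_of_true (hc W (by omega)) (hc (W + 1) (by omega))
      (hne W (by omega) (W + 1) (by omega) (by omega)) w hw
    have hc' : clEval (cswap c (h W) (h (W + 1))) w c = true := by
      rw [hw'eq]; simp [hc W (by omega), hc (W + 1) (by omega), hw]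
    obtain ⟨ih₀, ih₁, ih₂⟩ :=
      clEval_rotR_of_true (clEval (cswap c (h W) (h (W + 1))) w) hc' (W + 1)
        (fun j hj => hc j (by omega)) (fun i hi j hj => hinj i (by omega) j (by omega))
    simp only [rotR_succ_succ, clEval_append]
    refine ⟨fun i hi => ?_, fun j hj => ?_, fun _ => ?_⟩
    · rw [ih₀ i fun j hj => hi j (by omega), hw'eq]
      simp [hi W (by omega), hi (W + 1) (by omega)]
    · rcases Nat.lt_or_ge (j + 1) (W + 1) with hj' | hj'
      · rw [ih₁ j hj', hw'eq]
        simp [hne j (by omega) W (by omega) (by omega), hne j (by omega) (W + 1) (by omega) (by omega)]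
      · obtain rfl : W = j := by omega
        rw [ih₀ (h (W + 1)) fun j hj => hne (W + 1) (by omega) j (by omega) (by omega), hw'eq]
        simp [hne (W + 1) (by omega) W (by omega) (by omega)]
    · rw [ih₂ (by omega), hw'eq]
      simp [show W + 2 - 1 = W + 1 by omega, show W + 1 - 1 = W by omega]

/-- Right rotation, control set: the successor cell receives the value of its left neighbour. [cite: NishimuraOzawa2002, Thm. 4.3 (proof)] -/
theorem clEval_rotR_succ {c : ι} {h : ℕ → ι} {W : ℕ} (hc : ∀ j < W, c ≠ h j)
    (hinj : ∀ i < W, ∀ j < W, h i = h j → i = j) (w : ι → Bool) (hw : w c = true) {j : ℕ}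
    (hj : j + 1 < W) : clEval (rotR c h W) w (h (j + 1)) = w (h j) :=
  (clEval_rotR_of_true w hw W hc hinj).2.1 j hj

/-- Right rotation, control set: the first cell receives the value of the last one. [folklore] -/
theorem clEval_rotR_zero {c : ι} {h : ℕ → ι} {W : ℕ} (hc : ∀ j < W, c ≠ h j)
    (hinj : ∀ i < W, ∀ j < W, h i = h j → i = j) (w : ι → Bool) (hw : w c = true)
    (hW : 0 < W) : clEval (rotR c h W) w (h 0) = w (h (W - 1)) :=
  (clEval_rotR_of_true w hw W hc hinj).2.2 hW

/-- Right rotation: wires off the track are unchanged. [folklore] -/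
theorem clEval_rotR_of_forall_ne {c : ι} {h : ℕ → ι} {W : ℕ} (hc : ∀ j < W, c ≠ h j)
    (hinj : ∀ i < W, ∀ j < W, h i = h j → i = j) (w : ι → Bool) {i : ι}
    (hi : ∀ j < W, i ≠ h j) : clEval (rotR c h W) w i = w i := by
  cases hw : w c
  · rw [clEval_rotR_of_false w hw W hc hinj]
  · exact (clEval_rotR_of_true w hw W hc hinj).1 i hi

/-- **Left rotation, control set.** Wires off the track keep their values, `h j` receives the
value of `h (j + 1)` (`j + 1 < W`) and `h (W - 1)` that of `h 0`. [cite: NishimuraOzawa2002, Thm. 4.3 (proof)] -/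
theorem clEval_rotL_of_true {c : ι} {h : ℕ → ι} {W : ℕ} (hc : ∀ j < W, c ≠ h j)
    (hinj : ∀ i < W, ∀ j < W, h i = h j → i = j) (hW : 0 < W) :
    ∀ (w : ι → Bool), w c = true →
      (∀ i, (∀ j < W, i ≠ h j) → clEval (rotL c h W) w i = w i) ∧
      (∀ j, j + 1 < W → clEval (rotL c h W) w (h j) = w (h (j + 1))) ∧
      clEval (rotL c h W) w (h (W - 1)) = w (h 0) := by
  have hne : ∀ i < W, ∀ j < W, i ≠ j → h i ≠ h j :=
    fun i hi j hj hij e => hij (hinj i hi j hj e)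
  -- bubbling the value of `h 0` to the right: after the first `m` Fredkin gates it sits at `h m`
  suffices H : ∀ m, m < W → ∀ (w : ι → Bool), w c = true →
      (∀ i, (∀ j < W, i ≠ h j) →
        clEval ((List.range m).flatMap fun j => cswap c (h j) (h (j + 1))) w i = w i) ∧
      (∀ j, j < m → clEval ((List.range m).flatMap fun j => cswap c (h j) (h (j + 1))) w (h j) =
        w (h (j + 1))) ∧
      (∀ j, m < j → j < W →
        clEval ((List.range m).flatMap fun j => cswap c (h j) (h (j + 1))) w (h j) = w (h j)) ∧
      clEval ((List.range m).flatMap fun j => cswap c (h j) (h (j + 1))) w (h m) = w (h 0) by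
    intro w hw
    obtain ⟨H₀, H₁, -, H₃⟩ := H (W - 1) (by omega) w hw
    exact ⟨H₀, fun j hj => H₁ j (by omega), H₃⟩
  intro m
  induction m with
  | zero =>
    intro _ w _
    simp
  | succ m ih =>
    intro hm w hw
    obtain ⟨ih₀, ih₁, ih₂, ih₃⟩ := ih (by omega) w hw
    have hc' : clEval ((List.range m).flatMap fun j => cswap c (h j) (h (j + 1))) w c = true := by
      rw [ih₀ c fun j hj => hc j hj]; exact hw
    have hlast := clEval_cswap_of_true (hc m (by omega)) (hc (m + 1) hm)
      (hne m (by omega) (m + 1) hm (by omega)) _ hc'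
    simp only [List.range_succ, List.flatMap_append, List.flatMap_singleton, clEval_append]
    rw [hlast]
    refine ⟨fun i hi => ?_, fun j hj => ?_, fun j hj hjW => ?_, ?_⟩
    · simp [hi m (by omega), hi (m + 1) hm, ih₀ i hi]
    · rcases Nat.lt_or_ge j m with hjm | hjm
      · simp [hne j (by omega) m (by omega) (by omega), hne j (by omega) (m + 1) hm (by omega),
          ih₁ j hjm]
      · obtain rfl : m = j := by omega
        simp [ih₂ (m + 1) (by omega) hm]
    · simp [hne j hjW m (by omega) (by omega), hne j hjW (m + 1) hm (by omega), ih₂ j (by omega) hjW]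
    · simp [hne (m + 1) hm m (by omega) (by omega), ih₃]

/-- Left rotation, control set: each cell receives the value of its right neighbour. [cite: NishimuraOzawa2002, Thm. 4.3 (proof)] -/
theorem clEval_rotL_of_succ {c : ι} {h : ℕ → ι} {W : ℕ} (hc : ∀ j < W, c ≠ h j)
    (hinj : ∀ i < W, ∀ j < W, h i = h j → i = j) (w : ι → Bool) (hw : w c = true) {j : ℕ}
    (hj : j + 1 < W) : clEval (rotL c h W) w (h j) = w (h (j + 1)) :=
  (clEval_rotL_of_true hc hinj (by omega) w hw).2.1 j hj

/-- Left rotation, control set: the last cell receives the value of the first one. [folklore] -/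
theorem clEval_rotL_last {c : ι} {h : ℕ → ι} {W : ℕ} (hc : ∀ j < W, c ≠ h j)
    (hinj : ∀ i < W, ∀ j < W, h i = h j → i = j) (w : ι → Bool) (hw : w c = true)
    (hW : 0 < W) : clEval (rotL c h W) w (h (W - 1)) = w (h 0) :=
  (clEval_rotL_of_true hc hinj hW w hw).2.2

/-- Left rotation: wires off the track are unchanged. [folklore] -/
theorem clEval_rotL_of_forall_ne {c : ι} {h : ℕ → ι} {W : ℕ} (hc : ∀ j < W, c ≠ h j)
    (hinj : ∀ i < W, ∀ j < W, h i = h j → i = j) (w : ι → Bool) {i : ι}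
    (hi : ∀ j < W, i ≠ h j) : clEval (rotL c h W) w i = w i := by
  cases hw : w c
  · rw [clEval_rotL_of_false hc hinj w hw]
  · rcases Nat.eq_zero_or_pos W with rfl | hW
    · simp [rotL]
    · exact (clEval_rotL_of_true hc hinj hW w hw).1 i hi

/-! ### Parities and selective constant writes -/

/-- `CNOT`s from every wire of `srcs` into `t`: `t` receives the parity of `srcs`. [cite: NielsenChuang2010, §3.2.5] -/
def xorInto (srcs : List ι) (t : ι) : List (ClOp ι) :=
  srcs.map fun s => ClOp.cnot s t

omit [DecidableEq ι] in
/-- Well-formedness of `xorInto`: the target is not a source. [folklore] -/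
theorem wf_of_mem_xorInto {srcs : List ι} {t : ι} (ht : t ∉ srcs) {op : ClOp ι}
    (hop : op ∈ xorInto srcs t) : op.WF := by
  simp only [xorInto, List.mem_map] at hop
  obtain ⟨s, hs, rfl⟩ := hop
  exact fun h : s = t => ht (h ▸ hs)

/-- The parity of an assignment over a list of wires. [folklore] -/
def parity (w : ι → Bool) (srcs : List ι) : Bool :=
  (srcs.map w).foldr Bool.xor false

omit [DecidableEq ι] in
/-- Parity of a list starting with `s`. [folklore] -/
@[simp] theorem parity_cons (w : ι → Bool) (s : ι) (srcs : List ι) :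
    parity w (s :: srcs) = (w s ^^ parity w srcs) := rfl

omit [DecidableEq ι] in
/-- Parity of the empty list. [folklore] -/
@[simp] theorem parity_nil (w : ι → Bool) : parity w ([] : List ι) = false := rfl

omit [DecidableEq ι] in
/-- The parity of a list none of whose wires is set is `false`. [folklore] -/
theorem parity_eq_false_of_forall (w : ι → Bool) {srcs : List ι} (h : ∀ s ∈ srcs, w s = false) :
    parity w srcs = false := by
  induction srcs with
  | nil => rfl
  | cons s srcs ih =>
    rw [parity_cons, h s (by simp), ih fun s' hs' => h s' (by simp [hs'])]
    rfl

omit [DecidableEq ι] in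
/-- **One-hot parity**: if exactly the wire `a ∈ srcs` is set among `srcs` (duplicate-free),
the parity is `true`. [folklore] -/
theorem parity_eq_true_of_unique (w : ι → Bool) {srcs : List ι} (hnd : srcs.Nodup) {a : ι}
    (ha : a ∈ srcs) (hwa : w a = true) (h : ∀ s ∈ srcs, s ≠ a → w s = false) :
    parity w srcs = true := by
  induction srcs with
  | nil => simp at ha
  | cons s srcs ih =>
    rw [List.nodup_cons] at hnd
    rw [parity_cons]
    rcases List.mem_cons.1 ha with rfl | ha'
    · rw [hwa, parity_eq_false_of_forall w fun s' hs' => h s' (by simp [hs']) fun e => hnd.1 (e ▸ hs')]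
      rfl
    · rw [h s (by simp) fun e => hnd.1 (e ▸ ha'),
        ih hnd.2 ha' fun s' hs' hne => h s' (by simp [hs']) hne]
      rfl

/-- **Semantics of `xorInto` on the target**: `t` receives `w t ⊕ parity w srcs`. [cite: NielsenChuang2010, §3.2.5] -/
theorem clEval_xorInto_target {srcs : List ι} {t : ι} (ht : t ∉ srcs) (w : ι → Bool) :
    clEval (xorInto srcs t) w t = (w t ^^ parity w srcs) := by
  induction srcs generalizing w with
  | nil => simp [xorInto]
  | cons s srcs ih =>
    simp only [List.mem_cons, not_or] at ht
    have ih' := ih ht.2 (update w t (w t ^^ w s))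
    simp only [xorInto, List.map_cons, clEval_cons, ClOp.eval_cnot] at ih' ⊢
    rw [ih', update_self, parity_cons]
    have hp : parity (update w t (w t ^^ w s)) srcs = parity w srcs := by
      unfold parity
      congr 1
      exact List.map_congr_left fun s' hs' => update_of_ne (fun e : s' = t => ht.2 (e ▸ hs')) _ _
    rw [hp]
    cases w t <;> cases w s <;> cases parity w srcs <;> rfl

/-- `xorInto` changes only its target. [folklore] -/
theorem clEval_xorInto_of_ne {srcs : List ι} {t : ι} (w : ι → Bool) {i : ι} (hi : i ≠ t) :
    clEval (xorInto srcs t) w i = w i :=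
  clEval_apply_of_forall_target_ne _ _ fun op hop => by
    simp only [xorInto, List.mem_map] at hop
    obtain ⟨s, -, rfl⟩ := hop
    exact hi.symm

/-- **Selective constant write.** For every key `k ∈ ks`, write into the (fresh) wire `tgt k` the
bit `e₁ k` if the selector wire `x` is set and `e₀ k` otherwise: a `NOT` when `e₀ k` holds, then a
`CNOT` from `x` when `e₀ k ≠ e₁ k`. Used to load an input bit as the code of its tape symbol. [cite: NielsenChuang2010, §3.2.5] -/
def writeSel {κ : Type*} (x : ι) (tgt : κ → ι) (e₀ e₁ : κ → Bool) (ks : List κ) : List (ClOp ι) :=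
  ks.flatMap fun k =>
    (if e₀ k then [ClOp.not (tgt k)] else []) ++
      (if e₀ k = e₁ k then [] else [ClOp.cnot x (tgt k)])

omit [DecidableEq ι] in
/-- The targets of `writeSel` are the wires `tgt k`, `k ∈ ks`. [folklore] -/
theorem exists_of_mem_writeSel {κ : Type*} {x : ι} {tgt : κ → ι} {e₀ e₁ : κ → Bool} {ks : List κ}
    {op : ClOp ι} (hop : op ∈ writeSel x tgt e₀ e₁ ks) :
    ∃ k ∈ ks, op = ClOp.not (tgt k) ∨ op = ClOp.cnot x (tgt k) := by
  simp only [writeSel, List.mem_flatMap, List.mem_append] at hop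
  obtain ⟨k, hk, hop⟩ := hop
  refine ⟨k, hk, ?_⟩
  rcases hop with hop | hop
  · split_ifs at hop <;> simp at hop
    exact Or.inl hop
  · split_ifs at hop <;> simp at hop
    exact Or.inr hop

omit [DecidableEq ι] in
/-- Well-formedness of `writeSel`: the selector is not a target. [folklore] -/
theorem wf_of_mem_writeSel {κ : Type*} {x : ι} {tgt : κ → ι} {e₀ e₁ : κ → Bool} {ks : List κ}
    (hx : ∀ k ∈ ks, x ≠ tgt k) {op : ClOp ι} (hop : op ∈ writeSel x tgt e₀ e₁ ks) : op.WF := by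
  obtain ⟨k, hk, rfl | rfl⟩ := exists_of_mem_writeSel hop
  · trivial
  · exact hx k hk

/-- `writeSel` changes only its targets. [folklore] -/
theorem clEval_writeSel_of_forall_ne {κ : Type*} {x : ι} {tgt : κ → ι} {e₀ e₁ : κ → Bool}
    {ks : List κ} (w : ι → Bool) {i : ι} (hi : ∀ k ∈ ks, i ≠ tgt k) :
    clEval (writeSel x tgt e₀ e₁ ks) w i = w i :=
  clEval_apply_of_forall_target_ne _ _ fun op hop => by
    obtain ⟨k, hk, rfl | rfl⟩ := exists_of_mem_writeSel hop
    · exact (hi k hk).symm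
    · exact (hi k hk).symm

/-- **Semantics of `writeSel` on a target**: a fresh target `tgt k` (value `false`, targets
injective on `ks`, selector off the targets) ends up holding `if w x then e₁ k else e₀ k`. [cite: NielsenChuang2010, §3.2.5] -/
theorem clEval_writeSel_tgt {κ : Type*} {x : ι} {tgt : κ → ι} {e₀ e₁ : κ → Bool} {ks : List κ}
    (hx : ∀ k ∈ ks, x ≠ tgt k) (hinj : ∀ k ∈ ks, ∀ k' ∈ ks, tgt k = tgt k' → k = k')
    (hnd : ks.Nodup) (w : ι → Bool) {k : κ} (hk : k ∈ ks) (hfresh : w (tgt k) = false) :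
    clEval (writeSel x tgt e₀ e₁ ks) w (tgt k) = if w x then e₁ k else e₀ k := by
  induction ks generalizing w with
  | nil => simp at hk
  | cons k₀ ks ih =>
    rw [List.nodup_cons] at hnd
    have hx' : ∀ k ∈ ks, x ≠ tgt k := fun k hk => hx k (by simp [hk])
    have hinj' : ∀ k ∈ ks, ∀ k' ∈ ks, tgt k = tgt k' → k = k' :=
      fun k hk k' hk' => hinj k (by simp [hk]) k' (by simp [hk'])
    -- the chunk of `k₀`
    set chunk : List (ClOp ι) := (if e₀ k₀ then [ClOp.not (tgt k₀)] else []) ++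
      (if e₀ k₀ = e₁ k₀ then [] else [ClOp.cnot x (tgt k₀)]) with hchunk
    have hsplit : writeSel x tgt e₀ e₁ (k₀ :: ks) = chunk ++ writeSel x tgt e₀ e₁ ks := by
      simp [writeSel, hchunk]
    have hcx : clEval chunk w x = w x :=
      clEval_apply_of_forall_target_ne _ _ fun op hop => by
        simp only [hchunk, List.mem_append] at hop
        rcases hop with hop | hop <;> split_ifs at hop <;> simp at hop <;> subst hop
        · exact (hx k₀ (by simp)).symm
        · exact (hx k₀ (by simp)).symm
    have hcother : ∀ i, i ≠ tgt k₀ → clEval chunk w i = w i := fun i hi =>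
      clEval_apply_of_forall_target_ne _ _ fun op hop => by
        simp only [hchunk, List.mem_append] at hop
        rcases hop with hop | hop <;> split_ifs at hop <;> simp at hop <;> subst hop
        · exact hi.symm
        · exact hi.symm
    have hck₀ : w (tgt k₀) = false → clEval chunk w (tgt k₀) = if w x then e₁ k₀ else e₀ k₀ := by
      intro h0
      have hxt : x ≠ tgt k₀ := hx k₀ (by simp)
      simp only [hchunk]
      by_cases h₀ : e₀ k₀ = true <;> by_cases h₁ : e₁ k₀ = true <;>
        simp [h₀, h₁, ClOp.eval_not, ClOp.eval_cnot, update_self,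
          update_of_ne hxt, h0]
    rw [hsplit, clEval_append]
    rcases List.mem_cons.1 hk with rfl | hk'
    · rw [clEval_writeSel_of_forall_ne _ fun k' hk' e => hnd.1 ?_, hck₀ hfresh]
      have := hinj k (by simp) k' (by simp [hk']) e
      exact this ▸ hk'
    · have hne : tgt k ≠ tgt k₀ := fun e => hnd.1 (hinj k (by simp [hk']) k₀ (by simp) e ▸ hk')
      rw [ih hx' hinj' hnd.2 (clEval chunk w) hk' (by rw [hcother _ hne]; exact hfresh), hcx]

end YaoSim

end Literature.Computability.QuantumComplexity
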